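import Literature.Probability.LatticeModels.PlaneRotatorFreeTwoPoint
import Literature.Probability.LatticeModels.PlaneRotatorBoxSymmetry
import Literature.Probability.LatticeModels.PlaneRotatorPowerLawLowerBound
import HarnessLib

/-!
# Lattice symmetries of the infinite-volume two-point function of the plane rotator:
# `G_K(x + a, y + a) = G_K(x, y) = G_K(y, x) = G_K(σx, σy) = G_K(0, x − y)`

Topic `Literature/Probability/LatticeModels`. The infinite-volume (free-state) two-point function
`G_K(x, y) = sup_n ⟨cos(θ_x − θ_y)⟩_{[−n,n]^ν, K}` of the nearest-neighbour plane rotator on `ℤ^ν`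
(`PlaneRotator.infTwoPoint`, `PlaneRotatorFreeTwoPoint.lean`) is defined through the boxes CENTRED AT THE
ORIGIN, and the tree's statements about it (`summable_infTwoPoint_iff`, `infTwoPoint_decay_of_summable`,
Fröhlich–Spencer's Theorem C `FrohlichSpencerPowerLawLowerBound`, …) are accordingly written at base point `0`.
This file proves that `G_K` is invariant under the full symmetry group of `ℤ^ν` — translations (for `K ≥ 0`,
by Griffiths–Ginibre monotonicity in the volume: a translated box sits inside a larger box) and the
hyperoctahedral group of signed coordinate permutations (for every `K`: boxes are invariant) — and symmetric,
so that every base-point-`0` statement transfers to an arbitrary pair of sites: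

* `volTwoPoint_translate` — the finite-volume two-point function is carried along by a translation of the
  volume (relabelling, J. Ginibre, Comm. Math. Phys. **16** (1970) 310 [Ginibre1970], Example 4: the state is
  determined by the coupling array); `volTwoPoint_comm`; `volTwoPoint_box_signedPerm`.
* `infTwoPoint_translate` (`K ≥ 0`): `G_K(x + a, y + a) = G_K(x, y)`; `infTwoPoint_comm`: `G_K(x,y) = G_K(y,x)`
  (every `K`); `infTwoPoint_signedPerm` (every `K`): `G_K(σx, σy) = G_K(x, y)`; hence
  `infTwoPoint_eq_zero_sub` / `infTwoPoint_eq_zero_sub'`: `G_K(x, y) = G_K(0, y − x) = G_K(0, x − y)`,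
  `infTwoPoint_base_add`: `G_K(x, x + b) = G_K(0, b)`, `infTwoPoint_zero_neg`, `infTwoPoint_zero_signedPerm`.
* Transfer: `le_infTwoPoint_of_forall_zero` / `infTwoPoint_le_of_forall_zero` (a bound on `G_K(0, ·)` as a
  function of the displacement is a bound on `G_K(x, y)`), `summable_infTwoPoint_base_iff` and
  `tsum_infTwoPoint_base` (the susceptibility `χ(K) = ∑_y G_K(x, y)` does not depend on the base point `x`),
  `sum_sphere_infTwoPoint_base` (sphere sums around any centre).
* `FrohlichSpencerPowerLawLowerBound.lowerBound_pair` — Fröhlich–Spencer's Theorem C (J. Fröhlich, T. Spencer,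
  Comm. Math. Phys. **81** (1981) 527 [FrohlichSpencerKT1981], named fact of `PlaneRotatorPowerLawLowerBound.lean`)
  read at an arbitrary pair of sites: `G_K(x, y) ≥ C_K (1 + ‖x − y‖_∞)^{−1/(2πβ'(K))}` for `K ≥ K₁`.

Cell `pub/hubbard-tc` (MO-S3, K2 register of the classical comparison model; lane `p1`, ruling R83 (b) menu (i)):
number-neutral support lemmas. WHAT THIS IS NOT: no new estimate — symmetry bookkeeping for the existing ones;
not a statement about the Hubbard model.
-/

noncomputable section

open MeasureTheory Finset Filter Topology
open scoped BigOperators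

namespace Literature.Probability.LatticeModels

namespace PlaneRotator

open Literature.Barriers.CriticalPhenomena Literature.Barriers.CriticalPhenomena.LongRangeIsing
open Literature.Probability.Percolation (signedPerm_mem_box_iff)

variable [MeasurableSpace Circle] [BorelSpace Circle]

/-! ## §1 Finite volumes: translation, symmetry, hyperoctahedral invariance of the boxes -/

section Volume

variable {ν : ℕ}

omit [MeasurableSpace Circle] [BorelSpace Circle] in
/-- `z + a` lies in the translate `Λ + a` iff `z ∈ Λ`. [folklore] -/
private theorem add_mem_image_add_iff (Λ : Finset (Site ν)) (a z : Site ν) :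
    z + a ∈ Λ.image (· + a) ↔ z ∈ Λ := by
  constructor
  · intro h
    obtain ⟨w, hw, hwz⟩ := Finset.mem_image.1 h
    rwa [← add_right_cancel hwz]
  · exact fun h => Finset.mem_image_of_mem _ h

/-- **Translation covariance of the finite-volume two-point function** (every `K`): translating the volume
and both sites by `a ∈ ℤ^ν` does not change `⟨cos(θ_x − θ_y)⟩_{Λ,K}` — the nearest-neighbour coupling array
of `Λ + a` is the relabelled array of `Λ`, and the plane-rotator state is determined by its coupling array
(tree `twoPoint_comp_equiv`). [cite: Ginibre1970, Example 4 (plane rotators)] -/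
theorem volTwoPoint_translate (K : ℝ) (Λ : Finset (Site ν)) (a x y : Site ν) :
    volTwoPoint K ν (Λ.image (· + a)) (x + a) (y + a) = volTwoPoint K ν Λ x y := by
  have hmem := add_mem_image_add_iff Λ a
  by_cases h : x ∈ Λ ∧ y ∈ Λ
  · let e : Λ ≃ Λ.image (· + a) := (Equiv.addRight a).subtypeEquiv fun z => (hmem z).symm
    have he : ∀ u : Λ, ((e u : Λ.image (· + a)) : Site ν) = (u : Site ν) + a := fun _ => rfl
    rw [volTwoPoint_of_mem K h.1 h.2, volTwoPoint_of_mem K ((hmem x).2 h.1) ((hmem y).2 h.2)]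
    have key := twoPoint_comp_equiv e (nnXYCoupling K ν (Λ.image (· + a))) ⟨x, h.1⟩ ⟨y, h.2⟩
    have hJ : (fun q : Λ × Λ => nnXYCoupling K ν (Λ.image (· + a)) (e q.1, e q.2)) =
        nnXYCoupling K ν Λ := by
      funext q
      simp only [nnXYCoupling, nnCoupling, he, add_sub_add_right_eq_sub]
    rw [hJ] at key
    exact key.symm
  · have h' : ¬ (x + a ∈ Λ.image (· + a) ∧ y + a ∈ Λ.image (· + a)) := by rwa [hmem, hmem]
    unfold volTwoPoint
    rw [dif_neg h, dif_neg h']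

/-- The finite-volume two-point function is symmetric in the two sites (every `K`, every `Λ`).
[cite: Ginibre1970, Example 4 (plane rotators)] -/
theorem volTwoPoint_comm (K : ℝ) (Λ : Finset (Site ν)) (x y : Site ν) :
    volTwoPoint K ν Λ x y = volTwoPoint K ν Λ y x := by
  by_cases h : x ∈ Λ ∧ y ∈ Λ
  · rw [volTwoPoint_of_mem K h.1 h.2, volTwoPoint_of_mem K h.2 h.1]
    exact twoPoint_comm _ _ _
  · have h' : ¬ (y ∈ Λ ∧ x ∈ Λ) := fun hyx => h ⟨hyx.2, hyx.1⟩
    unfold volTwoPoint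
    rw [dif_neg h, dif_neg h']

/-- **Hyperoctahedral invariance of the free box** between lattice sites (every `K`): for a signed coordinate
permutation `σ` of `ℤ^ν`, `⟨cos(θ_{σx} − θ_{σy})⟩_{[−n,n]^ν} = ⟨cos(θ_x − θ_y)⟩_{[−n,n]^ν}` (tree
`twoPoint_nnXY_box_signedPerm`; the box is `σ`-invariant). [cite: Ginibre1970, Example 4 (plane rotators)] -/
theorem volTwoPoint_box_signedPerm (K : ℝ) (π : Equiv.Perm (Fin ν)) (ε : Fin ν → ℤˣ) (n : ℕ)
    (x y : Site ν) :
    volTwoPoint K ν (box ν n) (Site.signedPerm π ε x) (Site.signedPerm π ε y) =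
      volTwoPoint K ν (box ν n) x y := by
  by_cases h : x ∈ box ν n ∧ y ∈ box ν n
  · have hx : Site.signedPerm π ε x ∈ box ν n := (signedPerm_mem_box_iff π ε).2 h.1
    have hy : Site.signedPerm π ε y ∈ box ν n := (signedPerm_mem_box_iff π ε).2 h.2
    rw [volTwoPoint_of_mem K hx hy, volTwoPoint_of_mem K h.1 h.2]
    exact twoPoint_nnXY_box_signedPerm K π ε n ⟨x, h.1⟩ ⟨y, h.2⟩
  · have h' : ¬ (Site.signedPerm π ε x ∈ box ν n ∧ Site.signedPerm π ε y ∈ box ν n) := by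
      rwa [signedPerm_mem_box_iff, signedPerm_mem_box_iff]
    unfold volTwoPoint
    rw [dif_neg h', dif_neg h]

end Volume

/-! ## §2 The infinite volume: `G_K(x + a, y + a) = G_K(x, y) = G_K(y, x) = G_K(σx, σy)` -/

section Infinite

variable {ν : ℕ}

omit [MeasurableSpace Circle] [BorelSpace Circle] in
/-- A box is the translate by `a` of its translate by `−a`. [folklore] -/
private theorem box_eq_image_image (n : ℕ) (a : Site ν) :
    box ν n = ((box ν n).image (· + -a)).image (· + a) := by
  rw [Finset.image_image]
  have hid : ((· + a) ∘ (· + -a) : Site ν → Site ν) = id := by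
    funext z
    simp only [Function.comp_apply, neg_add_cancel_right, id_eq]
  rw [hid, Finset.image_id]

/-- **Translation invariance of the infinite-volume two-point function** (`K ≥ 0`):
`G_K(x + a, y + a) = G_K(x, y)`. The box `[−n,n]^ν` seen from `x + a, y + a` is the translate of a finite
volume seen from `x, y`, which is dominated by `G_K(x, y)` (Griffiths–Ginibre monotonicity in the volume,
tree `volTwoPoint_le_infTwoPoint`); by symmetry `a ↔ −a` the two suprema agree.
[cite: Ginibre1970, Prop. 3 with Example 4 (plane rotators); Simon1980CMP, Thm 1.3 (infinite-volume two-point function)] -/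
theorem infTwoPoint_translate {K : ℝ} (hK : 0 ≤ K) (a x y : Site ν) :
    infTwoPoint K ν (x + a) (y + a) = infTwoPoint K ν x y := by
  have key : ∀ b u v : Site ν, infTwoPoint K ν (u + b) (v + b) ≤ infTwoPoint K ν u v := by
    intro b u v
    refine infTwoPoint_le_of_forall_box fun n => ?_
    rw [box_eq_image_image n b, volTwoPoint_translate]
    exact volTwoPoint_le_infTwoPoint hK _ u v
  refine le_antisymm (key a x y) ?_
  have h := key (-a) (x + a) (y + a)
  rwa [add_neg_cancel_right, add_neg_cancel_right] at h

/-- **Symmetry**: `G_K(x, y) = G_K(y, x)` (every `K`). [cite: Ginibre1970, Example 4 (plane rotators)] -/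
theorem infTwoPoint_comm (K : ℝ) (x y : Site ν) : infTwoPoint K ν x y = infTwoPoint K ν y x := by
  unfold infTwoPoint
  congr 1
  funext n
  exact volTwoPoint_comm K _ x y

/-- **Hyperoctahedral invariance**: `G_K(σx, σy) = G_K(x, y)` for every signed coordinate permutation `σ` of
`ℤ^ν` (every `K`; the boxes are `σ`-invariant). [cite: Ginibre1970, Example 4 (plane rotators)] -/
theorem infTwoPoint_signedPerm (K : ℝ) (π : Equiv.Perm (Fin ν)) (ε : Fin ν → ℤˣ) (x y : Site ν) :
    infTwoPoint K ν (Site.signedPerm π ε x) (Site.signedPerm π ε y) = infTwoPoint K ν x y := by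
  unfold infTwoPoint
  congr 1
  funext n
  exact volTwoPoint_box_signedPerm K π ε n x y

/-- `G_K(0, σx) = G_K(0, x)`: the base-point-`0` two-point function depends only on the hyperoctahedral orbit
of `x` (every `K`). [cite: Ginibre1970, Example 4 (plane rotators)] -/
theorem infTwoPoint_zero_signedPerm (K : ℝ) (π : Equiv.Perm (Fin ν)) (ε : Fin ν → ℤˣ) (x : Site ν) :
    infTwoPoint K ν 0 (Site.signedPerm π ε x) = infTwoPoint K ν 0 x := by
  conv_lhs => rw [← Site.signedPerm_zero π ε]
  exact infTwoPoint_signedPerm K π ε 0 x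

/-- `G_K(0, −x) = G_K(0, x)` (every `K`; the point reflection is the signed permutation `π = 1`, `ε ≡ −1`).
[cite: Ginibre1970, Example 4 (plane rotators)] -/
theorem infTwoPoint_zero_neg (K : ℝ) (x : Site ν) : infTwoPoint K ν 0 (-x) = infTwoPoint K ν 0 x := by
  have h := infTwoPoint_zero_signedPerm K (Equiv.refl _) (fun _ => -1) x
  have hx : Site.signedPerm (Equiv.refl _) (fun _ => (-1 : ℤˣ)) x = -x := by
    funext i
    simp [Site.signedPerm_apply]
  rwa [hx] at h

/-- **Reduction to base point `0`** (`K ≥ 0`): `G_K(x, y) = G_K(0, y − x)`.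
[cite: Ginibre1970, Prop. 3 with Example 4 (plane rotators); Simon1980CMP, Thm 1.3] -/
theorem infTwoPoint_eq_zero_sub {K : ℝ} (hK : 0 ≤ K) (x y : Site ν) :
    infTwoPoint K ν x y = infTwoPoint K ν 0 (y - x) := by
  have h := infTwoPoint_translate hK (-x) x y
  rw [add_neg_cancel, ← sub_eq_add_neg] at h
  exact h.symm

/-- **Reduction to base point `0`**, displacement `x − y` (`K ≥ 0`): `G_K(x, y) = G_K(0, x − y)` — the form
matching the tree's decay statements in `‖x − y‖_∞`.
[cite: Ginibre1970, Prop. 3 with Example 4 (plane rotators); Simon1980CMP, Thm 1.3] -/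
theorem infTwoPoint_eq_zero_sub' {K : ℝ} (hK : 0 ≤ K) (x y : Site ν) :
    infTwoPoint K ν x y = infTwoPoint K ν 0 (x - y) := by
  rw [infTwoPoint_comm, infTwoPoint_eq_zero_sub hK]

/-- `G_K(x, x + b) = G_K(0, b)` (`K ≥ 0`). [cite: Ginibre1970, Prop. 3 with Example 4 (plane rotators)] -/
theorem infTwoPoint_base_add {K : ℝ} (hK : 0 ≤ K) (x b : Site ν) :
    infTwoPoint K ν x (x + b) = infTwoPoint K ν 0 b := by
  rw [infTwoPoint_eq_zero_sub hK, add_sub_cancel_left]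

/-- The diagonal is trivial: `G_K(x, x) = G_K(0, 0)` (`K ≥ 0`). [cite: Ginibre1970, Example 4 (plane rotators)] -/
theorem infTwoPoint_self {K : ℝ} (hK : 0 ≤ K) (x : Site ν) : infTwoPoint K ν x x = infTwoPoint K ν 0 0 := by
  rw [infTwoPoint_eq_zero_sub hK, sub_self]

end Infinite

/-! ## §3 Transfer of base-point-`0` statements to arbitrary pairs -/

section Transfer

variable {ν : ℕ}

/-- **Lower bounds transfer**: a lower bound on `G_K(0, ·)` as a function of the displacement is a lower bound on
`G_K(x, y)` at displacement `x − y` (`K ≥ 0`). [cite: Simon1980CMP, Thm 1.3 (infinite-volume two-point function)] -/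
theorem le_infTwoPoint_of_forall_zero {K : ℝ} (hK : 0 ≤ K) {f : Site ν → ℝ}
    (h : ∀ z : Site ν, f z ≤ infTwoPoint K ν 0 z) (x y : Site ν) : f (x - y) ≤ infTwoPoint K ν x y := by
  rw [infTwoPoint_eq_zero_sub' hK]
  exact h _

/-- **Upper bounds transfer**: an upper bound on `G_K(0, ·)` as a function of the displacement is an upper bound
on `G_K(x, y)` at displacement `x − y` (`K ≥ 0`). [cite: Simon1980CMP, Thm 1.3 (infinite-volume two-point function)] -/
theorem infTwoPoint_le_of_forall_zero {K : ℝ} (hK : 0 ≤ K) {f : Site ν → ℝ}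
    (h : ∀ z : Site ν, infTwoPoint K ν 0 z ≤ f z) (x y : Site ν) : infTwoPoint K ν x y ≤ f (x - y) := by
  rw [infTwoPoint_eq_zero_sub' hK]
  exact h _

omit [MeasurableSpace Circle] [BorelSpace Circle] in
/-- `y ↦ G(x, y)` is `G(0, ·)` precomposed with the bijection `y ↦ y − x`. [folklore] -/
private theorem comp_subRight_eq (g : Site ν → Site ν → ℝ) (hg : ∀ x y, g x y = g 0 (y - x)) (x : Site ν) :
    (fun y => g x y) = (fun y => g 0 y) ∘ Equiv.subRight x := by
  funext y
  simp only [Function.comp_apply, Equiv.subRight_apply]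
  exact hg x y

/-- **The susceptibility does not depend on the base point** (`K ≥ 0`): `∑_y G_K(x, y)` converges iff
`∑_y G_K(0, y)` does. [cite: Simon1980CMP, Thm 1.3 (χ = Σ_x ⟨σ₀σ_x⟩)] -/
theorem summable_infTwoPoint_base_iff {K : ℝ} (hK : 0 ≤ K) (x : Site ν) :
    (Summable fun y : Site ν => infTwoPoint K ν x y) ↔ Summable fun y : Site ν => infTwoPoint K ν 0 y := by
  rw [comp_subRight_eq (infTwoPoint K ν) (infTwoPoint_eq_zero_sub hK) x]
  exact Equiv.summable_iff _

/-- … and has the same value: `∑_y G_K(x, y) = ∑_y G_K(0, y) = χ(K)` (`K ≥ 0`).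
[cite: Simon1980CMP, Thm 1.3 (χ = Σ_x ⟨σ₀σ_x⟩)] -/
theorem tsum_infTwoPoint_base {K : ℝ} (hK : 0 ≤ K) (x : Site ν) :
    ∑' y : Site ν, infTwoPoint K ν x y = ∑' y : Site ν, infTwoPoint K ν 0 y := by
  have h := comp_subRight_eq (infTwoPoint K ν) (infTwoPoint_eq_zero_sub hK) x
  rw [show (∑' y : Site ν, infTwoPoint K ν x y) = ∑' y : Site ν, (fun y => infTwoPoint K ν x y) y from rfl, h]
  exact Equiv.tsum_eq (Equiv.subRight x) fun y => infTwoPoint K ν 0 y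

/-- **Sphere sums around any centre** (`K ≥ 0`): `∑_{‖b‖_∞ = R} G_K(x, x + b) = ∑_{‖b‖_∞ = R} G_K(0, b)` — the
quantity bounding Lieb's box number `S_R(K)` (tree `nnBoxShellSum_le_sum_sphere_infTwoPoint`) may be read off
around any site. [cite: Simon1980CMP, Thm 1.3; Lieb1980, p. 128 (the box B)] -/
theorem sum_sphere_infTwoPoint_base {K : ℝ} (hK : 0 ≤ K) (x : Site ν) (R : ℕ) :
    ∑ b ∈ sphere ν R, infTwoPoint K ν x (x + b) = ∑ b ∈ sphere ν R, infTwoPoint K ν 0 b :=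
  Finset.sum_congr rfl fun b _ => infTwoPoint_base_add hK x b

/-- Lieb's box number is bounded by the sphere sum of `G_K` around ANY centre (`K ≥ 0`):
`S_R(K) ≤ ∑_{‖b‖_∞ = R} G_K(x, x + b)`. [cite: Simon1980CMP, Thm 1.3; Lieb1980, p. 128 (the box B)] -/
theorem nnBoxShellSum_le_sum_sphere_infTwoPoint_base {K : ℝ} (hK : 0 ≤ K) (x : Site ν) (R : ℕ) :
    nnBoxShellSum K ν R ≤ ∑ b ∈ sphere ν R, infTwoPoint K ν x (x + b) := by
  rw [sum_sphere_infTwoPoint_base hK x R]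
  exact nnBoxShellSum_le_sum_sphere_infTwoPoint hK R

end Transfer

/-! ## §4 Fröhlich–Spencer's Theorem C at an arbitrary pair of sites -/

section FrohlichSpencer

/-- **Fröhlich–Spencer's power-law lower bound between arbitrary sites.** Granting Theorem C
(`FrohlichSpencerPowerLawLowerBound`, stated at base point `0`): there are `K₁ > 0` and `β'(K) → ∞` with
`β'(K) > 1/(4π)` and, for every `K ≥ K₁`, a constant `C_K > 0` such that
`G_K(x, y) ≥ C_K (1 + ‖x − y‖_∞)^{−1/(2πβ'(K))}` for ALL `x, y ∈ ℤ²` (translation invariance of the free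
state, `infTwoPoint_eq_zero_sub'`). [cite: FrohlichSpencerKT1981, §1.4 Theorem C (p. 534)] -/
theorem FrohlichSpencerPowerLawLowerBound.lowerBound_pair (hFS : FrohlichSpencerPowerLawLowerBound) :
    ∃ K₁ : ℝ, 0 < K₁ ∧ ∃ β' : ℝ → ℝ, Tendsto β' atTop atTop ∧
      ∀ K : ℝ, K₁ ≤ K →
        1 / (4 * Real.pi) < β' K ∧
          ∃ C : ℝ, 0 < C ∧ ∀ x y : Site 2,
            C * (1 + (Site.supNorm (x - y) : ℝ)) ^ (-(1 / (2 * Real.pi * β' K))) ≤ infTwoPoint K 2 x y := by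
  obtain ⟨K₁, hK₁, β', hβ', h⟩ := hFS
  refine ⟨K₁, hK₁, β', hβ', fun K hK => ?_⟩
  obtain ⟨hβ, C, hC, hCx⟩ := h K hK
  refine ⟨hβ, C, hC, fun x y => ?_⟩
  exact le_infTwoPoint_of_forall_zero (hK₁.le.trans hK)
    (f := fun z => C * (1 + (Site.supNorm z : ℝ)) ^ (-(1 / (2 * Real.pi * β' K)))) hCx x y

/-- Under Theorem C, for `K ≥ K₁` the two-point function is NOT summable around any base point `x`
(`χ(K) = ∑_y G_K(x, y) = ∞`; tree `FrohlichSpencerPowerLawLowerBound.not_summable` at `x = 0`).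
[cite: FrohlichSpencerKT1981, §1.4 Theorem C (p. 534)] -/
theorem FrohlichSpencerPowerLawLowerBound.not_summable_base (hFS : FrohlichSpencerPowerLawLowerBound) :
    ∃ K₁ : ℝ, 0 < K₁ ∧ ∀ K : ℝ, K₁ ≤ K → ∀ x : Site 2, ¬ Summable fun y : Site 2 => infTwoPoint K 2 x y := by
  obtain ⟨K₁, hK₁, β', -, h⟩ := hFS
  refine ⟨K₁, hK₁, fun K hK x => ?_⟩
  obtain ⟨-, C, hC, hCx⟩ := h K hK
  rw [summable_infTwoPoint_base_iff (hK₁.le.trans hK)]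
  exact not_summable_infTwoPoint_of_powerLaw_lowerBound (hK₁.le.trans hK) hC hCx

end FrohlichSpencer

end PlaneRotator

end Literature.Probability.LatticeModels

end
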